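import Literature.AlgebraicGeometry.HodgeTheory.GysinBaseChangeOfKunneth
import Literature.AlgebraicGeometry.HodgeTheory.GysinBaseChange
import Literature.AlgebraicGeometry.HodgeTheory.SupportedClassesRationalProofs
import HarnessLib

/-!
# Non-zero rational top classes and the cross product `pr_X^* a ∪ pr_Z^* w ≠ 0`

Three topological lemmas on the complex points of smooth projective complex varieties (theorems only,
no definitions, no named facts), inputs of the companion Weil surface
(`Literature/AlgebraicGeometry/HodgeTheory/WeilClassesSurfacesAlgebraic`):

* `exists_isRationalClass_top_ne_zero` — `X` smooth projective of dimension `n` has a NON-ZERO RATIONAL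
  class in `H²ⁿ(X(ℂ); ℂ)` (`[X(ℂ)] ≠ 0` is detected by some class by universal coefficients over `ℂ`,
  and the rational classes span, `span_isRationalClass_eq_top_of_isSmoothProjective_holds`);
* `complexGysin_fst_map_snd_ne_zero_of_ne_zero` — for `0 ≠ w ∈ H²ⁿ(Z(ℂ))` the fibre integral
  `(pr_X)_* pr_Z^* w ∈ H⁰(X(ℂ))` is non-zero (Künneth spanning in the top degree of `X × Z`,
  `kunnethSpan_complexBetti`, and Poincaré duality `OrientationFamily.hasPoincareDuality`; the argument
  of `exists_complexGysin_map_ne_zero`);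
* `cupProduct_map_fst_map_snd_ne_zero` — hence `pr_X^* a ∪ pr_Z^* w ≠ 0` for `a ≠ 0` (projection
  formula `complexGysin_cup`: `pr_{X*}(pr_X^* a ∪ pr_Z^* w) = a ∪ pr_{X*} pr_Z^* w = ε a`, `ε ≠ 0`).

## References

* A. Hatcher, *Algebraic Topology* (2002), §3.1 Thm. 3.2, §3.2 Thm. 3.15, §3.3 Thm. 3.26. [HatcherAT2002]
* W. Fulton, *Young Tableaux* (1997), Appendix B §B.1 (5), (6). [FultonYoungTableaux1997]
-/

noncomputable section

open CategoryTheory MonoidalCategory CartesianMonoidalCategory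
open scoped Manifold ContDiff ComplexConjugate
open Literature.AlgebraicGeometry.Motives Literature.Geometry.Kaehler Literature.NumberTheory.Transcendental
open Literature.AlgebraicTopology.SingularHomology

namespace Literature.AlgebraicGeometry.HodgeTheory

/-! ### Generic inputs: a non-zero rational top class; the fibre integral of a top class -/

section Generic

variable {l n : ℕ} {X Z : Motives.SchemeOver ℂ}

/-- **A smooth projective complex variety has a non-zero RATIONAL class of top degree**: `[X(ℂ)] ≠ 0`
is detected by some class (universal coefficients over `ℂ`), and the rational classes span
(`span_isRationalClass_eq_top_of_isSmoothProjective_holds`). [cite: HatcherAT2002, §3.3 Thm. 3.26 and §3.1 Thm. 3.2] -/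
theorem exists_isRationalClass_top_ne_zero (μ : OrientationFamily) (hX : Motives.IsSmoothProjective n X) :
    ∃ w : complexBetti X (2 * n), w ≠ 0 ∧ IsRationalClass w := by
  letI := hX.chartedSpace
  haveI := Motives.ComplexPoints.compactSpace_of_isSmoothProjective hX
  haveI := Motives.ComplexPoints.t2Space_of_isSmoothProjective hX
  haveI := connectedSpace_complexPoints hX
  have hne : (μ hX).fundamentalClass ≠ 0 := fundamentalClass_ne_zero (μ hX)
  obtain ⟨θ, hθ⟩ : ∃ θ : Module.Dual ℂ (singularHomology ℂ ℂ (Motives.ComplexPoints X) (2 * n)),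
      θ (μ hX).fundamentalClass ≠ 0 := by
    by_contra h
    push Not at h
    exact hne ((Module.forall_dual_apply_eq_zero_iff ℂ _).1 h)
  obtain ⟨G₀, hG₀⟩ := kroneckerPairing_surjective ℂ (Motives.ComplexPoints X) (2 * n) θ
  have hG₀ne : G₀ ≠ 0 := by
    rintro rfl
    rw [map_zero] at hG₀
    exact hθ (by rw [← hG₀, LinearMap.zero_apply])
  by_contra hall
  push Not at hall
  have htop := span_isRationalClass_eq_top_of_isSmoothProjective_holds n X hX (2 * n)
  have hbot : Submodule.span ℂ {c : complexBetti X (2 * n) | IsRationalClass c} = ⊥ := by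
    rw [Submodule.span_eq_bot]
    intro c hc
    by_contra h
    exact hall c h hc
  rw [hbot] at htop
  exact hG₀ne (by
    have : (G₀ : complexBetti X (2 * n)) ∈ (⊤ : Submodule ℂ _) := Submodule.mem_top
    rwa [← htop, Submodule.mem_bot] at this)

/-- **A non-zero top class of `Z` has non-zero fibre integral over `X × Z → X`**: for
`0 ≠ w ∈ H²ⁿ(Z(ℂ); ℂ)`, `(pr_X)_* pr_Z^* w ≠ 0` in `H⁰(X(ℂ); ℂ)` (Künneth spanning in the top degree,
`kunnethSpan_complexBetti`; Poincaré duality, `OrientationFamily.hasPoincareDuality`; verbatim the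
argument of `exists_complexGysin_map_ne_zero`). [cite: HatcherAT2002, §3.2 Thm. 3.15 and §3.1 Thm. 3.2]
[cite: FultonYoungTableaux1997, Appendix B §B.1 (5)] -/
theorem complexGysin_fst_map_snd_ne_zero_of_ne_zero (μ : OrientationFamily)
    (hX : Motives.IsSmoothProjective l X) (hZ : Motives.IsSmoothProjective n Z)
    {w : complexBetti Z (2 * n)} (hw : w ≠ 0) :
    complexGysin μ (Motives.IsSmoothProjective.tensor_holds hX hZ) hX (fst X Z)
        (show 2 * n + 2 * l = 0 + 2 * (l + n) by omega) (complexBetti.map (snd X Z) (2 * n) w) ≠ 0 := by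
  have hμ : μ.HasPoincareDuality := OrientationFamily.hasPoincareDuality μ
  have hT := Motives.IsSmoothProjective.tensor_holds hX hZ
  letI := hT.chartedSpace
  haveI := Motives.ComplexPoints.compactSpace_of_isSmoothProjective hT
  haveI := Motives.ComplexPoints.t2Space_of_isSmoothProjective hT
  haveI := connectedSpace_complexPoints hT
  intro h0
  set κ := kroneckerPairing ℂ ℂ (Motives.ComplexPoints (X ⊗ Z)) (2 * (l + n)) with hκ
  have hne : (μ hT).fundamentalClass ≠ 0 := fundamentalClass_ne_zero (μ hT)
  obtain ⟨θ, hθ⟩ : ∃ θ : Module.Dual ℂ (singularHomology ℂ ℂ (Motives.ComplexPoints (X ⊗ Z))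
      (2 * (l + n))), θ (μ hT).fundamentalClass ≠ 0 := by
    by_contra h
    push Not at h
    exact hne ((Module.forall_dual_apply_eq_zero_iff ℂ _).1 h)
  obtain ⟨G₀, hG₀⟩ := kroneckerPairing_surjective ℂ (Motives.ComplexPoints (X ⊗ Z)) (2 * (l + n)) θ
  have hG₀ne : κ G₀ (μ hT).fundamentalClass ≠ 0 := by rw [hκ, hG₀]; exact hθ
  apply hG₀ne
  have key : ∀ (a : complexBetti X (2 * l)) (w' : complexBetti Z (2 * n)),
      κ (cupProduct (two_mul_add_two_mul l n) (complexBetti.map (fst X Z) (2 * l) a)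
        (complexBetti.map (snd X Z) (2 * n) w')) (μ hT).fundamentalClass = 0 := by
    intro a w'
    obtain ⟨t, rfl⟩ := exists_eq_smul_of_top μ hZ hw w'
    have hsign : ((-1 : ℂ) ^ (2 * l * (2 * n))) = 1 := Even.neg_one_pow ⟨l * (2 * n), by ring⟩
    rw [map_smul, map_smul, map_smul, LinearMap.smul_apply, smul_eq_mul]
    refine mul_eq_zero_of_right t ?_
    rw [cupProduct_gradedComm_holds ℂ _ _ (show 2 * n + 2 * l = 2 * (l + n) by omega), hsign,
      one_smul, hκ, kroneckerPairing_cupProduct]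
    change kroneckerPairing ℂ ℂ _ _ (singularCohomology.map ℂ ℂ
      (Motives.AlgPoints.mapContinuous (L := ℂ) (fst X Z)) _ a) _ = 0
    rw [kroneckerPairing_map, ← capProduct_complexGysin hμ hT hX (fst X Z)
      (show 2 * n + 2 * l = 0 + 2 * (l + n) by omega) _ (Nat.zero_add _), h0,
      map_zero, LinearMap.zero_apply, map_zero]
  have hle : Submodule.span ℂ {v | ∃ (i j : ℕ) (h : i + j = 2 * (l + n)) (a : complexBetti X i)
        (w : complexBetti Z j),
        v = cupProduct h (complexBetti.map (fst X Z) i a) (complexBetti.map (snd X Z) j w)} ≤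
      LinearMap.ker (κ.flip (μ hT).fundamentalClass) := by
    refine Submodule.span_le.2 ?_
    rintro _ ⟨i, j, h, a, v, rfl⟩
    rw [SetLike.mem_coe, LinearMap.mem_ker, LinearMap.flip_apply]
    rcases lt_trichotomy (2 * l) i with hi | hi | hi
    · haveI := subsingleton_complexBetti hX hi
      rw [Subsingleton.elim a 0, map_zero, map_zero, LinearMap.zero_apply, map_zero,
        LinearMap.zero_apply]
    swap
    · haveI := subsingleton_complexBetti hZ (show 2 * n < j by omega)
      rw [Subsingleton.elim v 0, map_zero, map_zero, map_zero, LinearMap.zero_apply]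
    subst hi
    obtain rfl : j = 2 * n := by omega
    exact key a v
  have hmem := hle (kunnethSpan_complexBetti hX hZ (2 * (l + n)) G₀)
  rwa [LinearMap.mem_ker, LinearMap.flip_apply] at hmem

/-- **`pr_X^* a ∪ pr_Z^* w ≠ 0`** for `a ≠ 0` on `X` and `w ≠ 0` of top degree on `Z` (projection
formula: `pr_{X*}(pr_X^* a ∪ pr_Z^* w) = a ∪ pr_{X*} pr_Z^* w = ε a` with `ε ≠ 0`).
[cite: FultonYoungTableaux1997, Appendix B §B.1 (6)] -/
theorem cupProduct_map_fst_map_snd_ne_zero (μ : OrientationFamily)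
    (hX : Motives.IsSmoothProjective l X) (hZ : Motives.IsSmoothProjective n Z) {k m : ℕ}
    (hkm : k + 2 * n = m) {a : complexBetti X k} (ha : a ≠ 0) {w : complexBetti Z (2 * n)} (hw : w ≠ 0) :
    cupProduct hkm (complexBetti.map (fst X Z) k a) (complexBetti.map (snd X Z) (2 * n) w) ≠ 0 := by
  intro h
  have hg := complexGysin_fst_map_snd_ne_zero_of_ne_zero μ hX hZ hw
  set g := complexGysin μ (Motives.IsSmoothProjective.tensor_holds hX hZ) hX (fst X Z)
      (show 2 * n + 2 * l = 0 + 2 * (l + n) by omega) (complexBetti.map (snd X Z) (2 * n) w) with hgdef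
  obtain ⟨ε, hε⟩ := exists_eq_smul_one μ hX g
  have hε0 : ε ≠ 0 := fun h0 ↦ hg (by rw [hε, h0, zero_smul])
  have hproj := complexGysin_cup (OrientationFamily.hasPoincareDuality μ)
    (Motives.IsSmoothProjective.tensor_holds hX hZ) hX (fst X Z) hkm
    (show m + 2 * l = k + 2 * (l + n) by omega) (show 2 * n + 2 * l = 0 + 2 * (l + n) by omega)
    (Nat.add_zero k) a (complexBetti.map (snd X Z) (2 * n) w)
  rw [h, map_zero, ← hgdef, hε, map_smul, cupProduct_one] at hproj
  exact ha ((smul_eq_zero.mp hproj.symm).resolve_left hε0)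

end Generic

end Literature.AlgebraicGeometry.HodgeTheory

end
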